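import Literature.Computability.QuantumComplexity.RazTalMachine
import Literature.Computability.QuantumComplexity.RevTableauUniform
import Literature.Computability.QuantumComplexity.OracleSeparationBQPPHProofs
import Literature.Computability.Complexity.GenProgramsTwo
import Literature.Computability.Complexity.FinitePatching
import Literature.Computability.Complexity.TM2PassThrough
import HarnessLib

/-!
# The Raz–Tal `BQP^O` machine, III: uniformity; discharge of `RazTal2022_bqpMachine`

Sequel of `RazTalMachine.lean`. The family `rtFamily n₀ tbl` (the hard-wired circuits below `n₀`,
the big circuit `bigCirc n` — pre-processing, `m = rtBlocks n` one-query Forrelation blocks,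
token count, threshold — from `n₀` on) is **polynomial-time uniform** (`rtFamily_isUniform`),
whence the named fact `RazTal2022_bqpMachine` of `OracleSeparationBQPPH.lean`
(`razTal2022_bqpMachine_holds`: Raz–Tal, J. ACM 69 (2022), App. A, "this is a `BQP` machine since
`Q₁` runs in `poly(n)` time"); the oracle separation `BQP^O ⊄ PH^O` itself (Raz–Tal, Cor. 1.5) is
assembled in `OracleSeparationsProofs.lean`.

Following `RevTableauUniform.lean` (Arora–Barak 2009, §6.2 and proof of Thm. 6.15, "output the
description gate by gate, keeping counters"), no machine is written: the description
`sigmaEncode ⟨n, rtAnc n, bigCirc n⟩` is the rendered stream of a *generator program* with two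
input counters `n` and `L = size (rtBlocks n)` (`GenProgramsTwo.lean`; the second counter is
supplied by a one-counter generator printing `1ⁿ 0` and the binary numeral of `rtBlocks n`), and
the hard-wired lengths are a finite patch (`FinitePatching.lean`).

* descriptions of compiled `RtOp` programs as bit streams and token streams (`gateEnc_oracle`,
  `RtOp.bits`, `flatMap_gateEnc_compileList`, `RtOp.toks`, `render_flatMap_rtoks`);
* the generator `descG` (layout quantities as counter expressions; one statement per loop of
  `allOps`), `out_descG`, `render_out_descG`;
* `descBig_mem_FP`, `rtFamily_isUniform` (namespace `Literature.QuantumAdvantage.RazTalMachine`), and, in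
  `Literature.QuantumAdvantage`, `razTal2022_bqpMachine_holds`.

## References

* R. Raz, A. Tal, *Oracle separation of BQP and PH*, J. ACM 69 (2022), App. A [RazTalJACM2022].
* S. Arora, B. Barak, *Computational Complexity: A Modern Approach*, CUP 2009, §6.2, Thm. 6.15
  (proof), §1.3.
-/

namespace Literature.Computability.QuantumComplexity

open _root_.Computability Complexity Cryptography RevDesc RevSim
open Complexity.SProg (dbl dbl_nil dbl_cons)

namespace RazTalMachine

/-! ### Descriptions of compiled `RtOp` programs -/

section Desc

variable {N : ℕ}

/-- The description bits of an oracle query with `k` query wires and wires `ws` (query wires,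
then the answer wire): tag `1`, arity `k` in binary, `1^{4(k+1)}`, the wires, the terminator.
[Arora–Barak 2009, §6.1] [folklore] -/
def oracleBits (k : ℕ) (ws : List ℕ) : List Bool :=
  [true, true] ++ Tok.numeral 4 k ++ [false, false, true, true] ++ List.replicate (4 * (k + 1)) true ++
    [false, false, true, true] ++ ws.flatMap wireBits ++ [false, true]

/-- **The contribution of a placed oracle query to `QCircuit.encode`.** [Arora–Barak 2009, §6.1] [folklore] -/
theorem gateEnc_oracle (k : ℕ) (e : Fin (k + 1) ↪ Fin N) :
    gateEnc (QGate.oracle k e : QGate cliffordT N) = oracleBits k (List.ofFn fun i => (e i : ℕ)) := by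
  simp only [gateEnc, QGate.encode, oracleBits]
  rw [boolPair_eq]
  change dbl (true :: (dbl (encodeNat k) ++ [false, true] ++
    boolPair (unaryEncodeNat (List.ofFn fun i => (e i : ℕ)).length)
      ((List.ofFn fun i => (e i : ℕ)).foldr (fun a acc => boolPair (encodeNat a) acc) []))) ++ [false, true] = _
  rw [boolPair_eq, List.length_ofFn, RevDesc.unaryEncodeNat_eq_replicate]
  simp only [dbl_cons, dbl_append, dbl_replicate, dbl_foldr_boolPair, dbl_dbl_encodeNat]
  simp [show 2 * (2 * (k + 1)) = 4 * (k + 1) by ring]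

/-- The abstract Clifford+T gates of the controlled-Hadamard word (`qList` on the target, `CZ` as
`H, CNOT, H`, `pList` on the target). [folklore] -/
def chadAGates {α : Type} (c a : α) : List (AGate α) :=
  [⟨.S, [a]⟩, ⟨.S, [a]⟩, ⟨.S, [a]⟩, ⟨.H, [a]⟩, ⟨.S, [a]⟩, ⟨.S, [a]⟩, ⟨.S, [a]⟩, ⟨.T, [a]⟩, ⟨.H, [a]⟩, ⟨.S, [a]⟩,
    ⟨.H, [a]⟩, ⟨.CNOT, [c, a]⟩, ⟨.H, [a]⟩,
    ⟨.S, [a]⟩, ⟨.S, [a]⟩, ⟨.S, [a]⟩, ⟨.H, [a]⟩, ⟨.T, [a]⟩, ⟨.H, [a]⟩, ⟨.S, [a]⟩]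

/-- `chadAGates` commutes with re-indexing. [folklore] -/
theorem chadAGates_map {α β : Type} (f : α → β) (c a : α) : chadAGates (f c) (f a) = (chadAGates c a).map (AGate.map f) := rfl

/-- **The description bits of an operation** (wires in `ℕ`). [folklore] -/
def RtOp.bits : RtOp ℕ → List Bool
  | .cl op => opBits op
  | .had a => gateBits 0 1 [a]
  | .chad c a => (chadAGates c a).flatMap AGate.bits
  | .oracle qs t => oracleBits qs.length (qs ++ [t])

/-- **The compiled operation describes as `RtOp.bits`** (wires below `N`). [folklore] -/
theorem flatMap_gateEnc_compile (hN : 0 < N) (op : RtOp ℕ) (hlt : ∀ w ∈ op.wires, w < N)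
    (h : (op.map (finOf N hN)).WF) : ((op.map (finOf N hN)).compile h).flatMap gateEnc = op.bits := by
  cases op with
  | cl op => exact flatMap_gateEnc_compile_toRev hN op hlt h
  | had a =>
    have ha : (finOf N hN a : ℕ) = a := val_finOf_of_lt hN (hlt a (by simp [RtOp.wires]))
    simp [RtOp.map, RtOp.compile, gateEnc_hOn, RtOp.bits, ha]
  | chad c a =>
    have hc : (finOf N hN c : ℕ) = c := val_finOf_of_lt hN (hlt c (by simp [RtOp.wires]))
    have ha : (finOf N hN a : ℕ) = a := val_finOf_of_lt hN (hlt a (by simp [RtOp.wires]))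
    simp [RtOp.map, RtOp.compile, chWord, wireWord, qList, pList, czWord, G1.gate, gateEnc_hOn, gateEnc_sOn, gateEnc_tOn,
      gateEnc_cnotOn, RtOp.bits, chadAGates, AGate.bits, symCode, symArity, hc, ha]
  | oracle qs t =>
    simp only [RtOp.map, RtOp.compile, List.flatMap_cons, List.flatMap_nil, List.append_nil, gateEnc_oracle, RtOp.bits,
      List.length_map]
    congr 1
    have hval : ∀ w ∈ qs ++ [t], (finOf N hN w : ℕ) = w := fun w hw => val_finOf_of_lt hN (hlt w hw)
    have e : List.map (finOf N hN) qs ++ [finOf N hN t] = (qs ++ [t]).map (finOf N hN) := by simp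
    apply List.ext_getElem
    · simp
    · intro i h1 h2
      simp only [List.getElem_ofFn, oracleEmb, Function.Embedding.coeFn_mk, List.get_eq_getElem, Fin.val_cast,
        List.getElem_of_eq e, List.getElem_map]
      exact hval _ (List.getElem_mem _)

/-- **The compiled program describes as the concatenation of the `RtOp.bits`.** [folklore] -/
theorem flatMap_gateEnc_compileList (hN : 0 < N) : ∀ (ops : List (RtOp ℕ)) (_ : ∀ op ∈ ops, ∀ w ∈ op.wires, w < N)
    (h : ∀ op ∈ ops.map (RtOp.map (finOf N hN)), op.WF),
    (RtOp.compileList (ops.map (RtOp.map (finOf N hN))) h).flatMap gateEnc = ops.flatMap RtOp.bits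
  | [], _, _ => by rfl
  | op :: ops, hlt, h => by
    change (RtOp.compile _ _ ++ RtOp.compileList (ops.map (RtOp.map (finOf N hN))) _).flatMap gateEnc = _
    rw [List.flatMap_append, List.flatMap_cons, flatMap_gateEnc_compile hN op (hlt op (by simp)),
      flatMap_gateEnc_compileList hN ops (fun o ho => hlt o (by simp [ho]))]

/-- **The description of the big circuit is the concatenation of the `RtOp.bits` of `allOps`.**
[Arora–Barak 2009, §6.1] [folklore] -/
theorem encode_bigCirc (n : ℕ) : QCircuit.encode (bigCirc n) = (allOps n).flatMap RtOp.bits := by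
  rw [bigCirc, encode_eq_flatMap]
  exact flatMap_gateEnc_compileList rtW_pos (allOps n) allOps_lt _

/-! ### Token streams of the descriptions -/

/-- The tokens of an oracle query: as `oracleBits`, with the arity and the wires as numerals. [folklore] -/
def oracleToks (k : ℕ) (ws : List ℕ) : List Tok :=
  litT [true, true] ++ (List.replicate k Tok.tick ++ Tok.dump true true ::
    (litT [false, false, true, true] ++ (litT (List.replicate (4 * (k + 1)) true) ++
      (litT [false, false, true, true] ++ (ws.flatMap wireToks ++ litT [false, true])))))

/-- The tokens of an operation. [folklore] -/
def RtOp.toks : RtOp ℕ → List Tok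
  | .cl op => opToks op
  | .had a => gateToks 0 1 [a]
  | .chad c a => (chadAGates c a).flatMap AGate.toks
  | .oracle qs t => oracleToks qs.length (qs ++ [t])

/-- Oracle tokens render to oracle bits. [folklore] -/
theorem render_oracleToks (k : ℕ) (ws : List ℕ) (B : List Tok) :
    Tok.render 0 (oracleToks k ws ++ B) = oracleBits k ws ++ Tok.render 0 B := by
  simp only [oracleToks, List.append_assoc, List.cons_append, render_litT, Tok.render_numeral, render_flatMap_wireToks]
  simp [oracleBits, List.append_assoc]

/-- Operation tokens render to operation bits. [folklore] -/
theorem render_rtoks (op : RtOp ℕ) (B : List Tok) : Tok.render 0 (op.toks ++ B) = op.bits ++ Tok.render 0 B := by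
  cases op with
  | cl op => simpa [RtOp.toks, RtOp.bits] using render_flatMap_opToks [op] B
  | had a => exact render_gateToks 0 1 [a] B
  | chad c a => exact render_flatMap_toks _ B
  | oracle qs t => exact render_oracleToks _ _ B

/-- **Program tokens render to the program description.** [folklore] -/
theorem render_flatMap_rtoks (ops : List (RtOp ℕ)) (B : List Tok) :
    Tok.render 0 (ops.flatMap RtOp.toks ++ B) = ops.flatMap RtOp.bits ++ Tok.render 0 B := by
  induction ops with
  | nil => rfl
  | cons op ops ih => rw [List.flatMap_cons, List.append_assoc, render_rtoks, ih, List.flatMap_cons, List.append_assoc]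

end Desc


/-! ### The generator program -/

namespace RtGen

/-- Counter variables of the generator: the input length `n`, the number of index bits `L`, the
block `i`, the round `r`, the inner index `l`, the position `c`, the tick counter, the filler. [folklore] -/
inductive RV where
  | xn | xL | bi | rr | ll | cc | tk | uu
  deriving DecidableEq, Fintype, Repr

/-- Counter expressions of the generator. [folklore] -/
abbrev GE : Type := GExpr RV

/-- Powers as iterated products, for generator expressions over any variable type (the case of
`RevSim.GV` is `RevSim.GE.pw` of `RevTableauUniform.lean`). [folklore] -/
def _root_.Literature.Computability.Complexity.GExpr.pw {V : Type} (a : GExpr V) : ℕ → GExpr V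
  | 0 => .const 1
  | m + 1 => .mul (a.pw m) a

/-- The value of a power expression. [folklore] -/
@[simp] theorem _root_.Literature.Computability.Complexity.GExpr.eval_pw {V : Type} (env : V → ℕ) (a : GExpr V) (m : ℕ) :
    (a.pw m).eval env = (a.eval env) ^ m := by
  induction m with
  | zero => simp [GExpr.pw, GExpr.eval]
  | succ m ih => simp [GExpr.pw, GExpr.eval, ih, pow_succ]

/-- Generator statements over the token alphabet. [folklore] -/
abbrev GS : Type := GStmt RV Tok

attribute [local simp] GExpr.eval

/-! #### Generic combinators (as in `RevTableauUniform`, over the present variables) -/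

/-- `w` ticks. [folklore] -/
def ticksG (w : GE) : GS := .loop .tk w (.emit [Tok.tick])

/-- The stream of `ticksG`. [folklore] -/
@[simp] theorem out_ticksG (w : GE) (env : RV → ℕ) : (ticksG w).out env = List.replicate (w.eval env) Tok.tick := by
  simp [ticksG, GStmt.out, flatMap_range_const]

/-- One wire index: ticks, dump, separator. [folklore] -/
def wireG (w : GE) : GS := .seq (ticksG w) (.emit (Tok.dump true true :: litT [false, false, true, true]))

/-- The stream of `wireG`. [folklore] -/
@[simp] theorem out_wireG (w : GE) (env : RV → ℕ) : (wireG w).out env = wireToks (w.eval env) := by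
  simp [wireG, GStmt.out, wireToks]

/-- One abstract gate. [folklore] -/
def agateG (g : AGate GE) : GS :=
  .seq (.emit (litT (gatePre (symCode g.sym) (symArity g.sym))))
    (.seq (seqs (g.wires.map wireG)) (.emit (litT [false, true])))

/-- The stream of `agateG`. [folklore] -/
@[simp] theorem out_agateG (g : AGate GE) (env : RV → ℕ) :
    (agateG g).out env = (g.map (GExpr.eval env)).toks := by
  simp [agateG, GStmt.out, AGate.toks, AGate.map, gateToks, List.flatMap_map]

/-- One classical reversible gate: its Clifford+T word. [folklore] -/
def opG (op : ClOp GE) : GS := seqs ((agates op).map agateG)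

/-- The stream of `opG`. [folklore] -/
@[simp] theorem out_opG (op : ClOp GE) (env : RV → ℕ) : (opG op).out env = (RtOp.cl (op.map (GExpr.eval env))).toks := by
  simp [opG, RtOp.toks, opToks, agates_map, List.flatMap_map]

/-- A Hadamard gate. [folklore] -/
def hadG (a : GE) : GS := agateG ⟨.H, [a]⟩

/-- The stream of `hadG`. [folklore] -/
@[simp] theorem out_hadG (a : GE) (env : RV → ℕ) : (hadG a).out env = (RtOp.had (a.eval env)).toks := by
  simp [hadG, RtOp.toks, AGate.toks, AGate.map, symCode, symArity]

/-- A controlled-Hadamard word. [folklore] -/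
def chadG (c a : GE) : GS := seqs ((chadAGates c a).map agateG)

/-- The stream of `chadG`. [folklore] -/
@[simp] theorem out_chadG (c a : GE) (env : RV → ℕ) :
    (chadG c a).out env = (RtOp.chad (c.eval env) (a.eval env)).toks := by
  simp [chadG, RtOp.toks, chadAGates_map, List.flatMap_map]

/-! #### The layout as counter expressions -/

/-- `n` [folklore] -/
def nE : GE := .var .xn
/-- `L` [folklore] -/
def LE : GE := .var .xL
/-- `m = 18496 n³` [folklore] -/
def mE : GE := .mul (.const 18496) (nE.pw 3)
/-- `m + 1` [folklore] -/
def m1E : GE := .add mE (.const 1)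
/-- the threshold `9248 n³ + 136 n²` [folklore] -/
def thrE : GE := .add (.mul (.const 9248) (nE.pw 3)) (.mul (.const 136) (nE.pw 2))
/-- the block size [folklore] -/
def BszE : GE := .add (.add (.add nE (.const 3)) LE) (.mul mE (.add LE (.const 1)))
/-- the number of ancillas [folklore] -/
def ancE : GE := .add (.add (.const 2) (.mul m1E m1E)) (.mul mE BszE)
/-- token wire [folklore] -/
def uWE (s c : GE) : GE := .add (.add (.add nE (.const 2)) (.mul s m1E)) c
/-- the base of block `i` [folklore] -/
def blkE (i : GE) : GE := .add (.add (.add nE (.const 2)) (.mul m1E m1E)) (.mul i BszE)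
/-- half selector of block `i` (global) [folklore] -/
def hGE (i : GE) : GE := .add (blkE i) nE
/-- a local wire shifted to block `bi` [folklore] -/
def sh (w : GE) : GE := .add w (blkE (.var .bi))
/-- local: target [folklore] -/
def tWL : GE := .add nE (.const 1)
/-- local: seed [folklore] -/
def oWL : GE := .add nE (.const 2)
/-- local: index bit `l` [folklore] -/
def bWL (l : GE) : GE := .add (.add nE (.const 3)) l
/-- local: carry `(r, l)` [folklore] -/
def kWL (r l : GE) : GE := .add (.add (.add (.add nE (.const 3)) LE) (.mul r (.add LE (.const 1)))) l

variable (env : RV → ℕ)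

/-- value of `mE` [folklore] -/
@[simp] theorem eval_mE : mE.eval env = rtBlocks (env .xn) := by simp [mE, nE, rtBlocks]
/-- value of `m1E` [folklore] -/
@[simp] theorem eval_m1E : m1E.eval env = rtBlocks (env .xn) + 1 := by simp [m1E]
/-- value of `thrE` [folklore] -/
@[simp] theorem eval_thrE : thrE.eval env = rtThreshold (env .xn) := by simp [thrE, nE, rtThreshold]
/-- value of `BszE` [folklore] -/
@[simp] theorem eval_BszE : BszE.eval env = Bsz (env .xn) (env .xL) := by simp [BszE, nE, LE, Bsz]
/-- value of `ancE` [folklore] -/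
@[simp] theorem eval_ancE (hL : env .xL = rtL (env .xn)) : ancE.eval env = rtAnc (env .xn) := by
  simp [ancE, rtAnc, hL]
/-- value of `uWE` [folklore] -/
@[simp] theorem eval_uWE (s c : GE) : (uWE s c).eval env = uW (env .xn) (s.eval env) (c.eval env) := by simp [uWE, uW, nE]
/-- value of `blkE` [folklore] -/
@[simp] theorem eval_blkE (i : GE) (hL : env .xL = rtL (env .xn)) : (blkE i).eval env = blkBase (env .xn) (i.eval env) := by
  simp [blkE, blkBase, nE, hL]
/-- value of `tWL` [folklore] -/
@[simp] theorem eval_tWL : tWL.eval env = tW (env .xn) := by simp [tWL, tW, nE]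
/-- value of `oWL` [folklore] -/
@[simp] theorem eval_oWL : oWL.eval env = oW (env .xn) := by simp [oWL, oW, nE]
/-- value of `bWL` [folklore] -/
@[simp] theorem eval_bWL (l : GE) : (bWL l).eval env = bW (env .xn) (l.eval env) := by simp [bWL, bW, nE]
/-- value of `kWL` [folklore] -/
@[simp] theorem eval_kWL (r l : GE) : (kWL r l).eval env = kW (env .xn) (env .xL) (r.eval env) (l.eval env) := by
  simp [kWL, kW, nE, LE]

/-! #### The gadgets as generator programs -/

/-- **one increment** (`incrOps` shifted to the current block) [folklore] -/
def incrG : GS :=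
  .seq (opG (ClOp.cnot (sh oWL) (sh (kWL (.var .rr) (.const 0)))))
    (.seq (.loop .ll LE (opG (ClOp.toffoli (sh (kWL (.var .rr) (.var .ll))) (sh (bWL (.var .ll)))
      (sh (kWL (.var .rr) (.add (.var .ll) (.const 1)))))))
      (.loop .ll LE (opG (ClOp.cnot (sh (kWL (.var .rr) (.var .ll))) (sh (bWL (.var .ll)))))))

/-- **the oracle query of the current block** [folklore] -/
def oracleG : GS :=
  .seq (.emit (litT [true, true]))
  (.seq (ticksG (.add (.add nE (.const 1)) LE))
  (.seq (.emit (Tok.dump true true :: litT [false, false, true, true]))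
  (.seq (.loop .cc (.mul (.const 4) (.add (.add (.add nE (.const 1)) LE) (.const 1))) (.emit [Tok.lit true]))
  (.seq (.emit (litT [false, false, true, true]))
  (.seq (.loop .ll (.add nE (.const 1)) (wireG (sh (.var .ll))))
  (.seq (.loop .ll LE (wireG (sh (bWL (.var .ll)))))
  (.seq (wireG (sh tWL)) (.emit (litT [false, true])))))))))

/-- **one block** (`blockOps` shifted to the current block) [folklore] -/
def blockG : GS :=
  .seq (opG (ClOp.not (sh oWL)))
  (.seq (.loop .rr (.var .bi) incrG)
  (.seq (opG (ClOp.not (sh tWL)))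
  (.seq (hadG (sh tWL))
  (.seq (.loop .ll (.add nE (.const 1)) (hadG (sh (.var .ll))))
  (.seq oracleG
  (.seq (.loop .ll nE (chadG (sh nE) (sh (.var .ll))))
    (hadG (sh nE))))))))

/-- **the pre-processing** [folklore] -/
def preG : GS :=
  seqs [opG (ClOp.cnot (.const 0) (.add nE (.const 1))), opG (ClOp.cnot (.add nE (.const 1)) (.const 0)),
    opG (ClOp.not (uWE (.const 0) (.const 0)))]

/-- **the token steps and the read-out** [folklore] -/
def postG : GS :=
  .seq (.loop .bi mE (.loop .cc mE (seqs
    [opG (ClOp.toffoli (uWE (.var .bi) (.var .cc)) (hGE (.var .bi)) (uWE (.add (.var .bi) (.const 1)) (.var .cc))),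
     opG (ClOp.not (hGE (.var .bi))),
     opG (ClOp.toffoli (uWE (.var .bi) (.var .cc)) (hGE (.var .bi)) (uWE (.add (.var .bi) (.const 1)) (.add (.var .cc) (.const 1)))),
     opG (ClOp.not (hGE (.var .bi)))])))
  (.seq (opG (ClOp.not (.const 0)))
    (.loop .cc thrE (opG (ClOp.cnot (uWE mE (.var .cc)) (.const 0)))))

/-- **the header** `dbl (bin n) ++ 01 ++ 1^{2 anc} ++ 01` [folklore] -/
def headerG : GS :=
  .seq (ticksG (.var .xn)) (.seq (.emit (Tok.dump false true :: litT [false, true]))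
    (.seq (.loop .uu (.mul (.const 2) ancE) (.emit [Tok.lit true])) (.emit (litT [false, true]))))

/-- **The generator program of the Raz–Tal family** (big circuits). [Arora–Barak 2009, §6.2 and proof of Thm. 6.15] [folklore] -/
def descG : GS :=
  .seq headerG (.seq preG (.seq (.loop .bi mE blockG) postG))

/-! ### The generated stream is the description -/

/-- `ClOp.map` on `not`. [folklore] -/
@[simp] theorem ClOp.map_not' {α β : Type} (f : α → β) (i : α) : (ClOp.not i).map f = ClOp.not (f i) := rfl
/-- `ClOp.map` on `cnot`. [folklore] -/
@[simp] theorem ClOp.map_cnot' {α β : Type} (f : α → β) (i j : α) : (ClOp.cnot i j).map f = ClOp.cnot (f i) (f j) := rfl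
/-- `ClOp.map` on `toffoli`. [folklore] -/
@[simp] theorem ClOp.map_toffoli' {α β : Type} (f : α → β) (a b c : α) :
    (ClOp.toffoli a b c).map f = ClOp.toffoli (f a) (f b) (f c) := rfl
/-- `RtOp.map` on `cl`. [folklore] -/
@[simp] theorem RtOp.map_cl' {α β : Type} (f : α → β) (op : ClOp α) : (RtOp.cl op).map f = RtOp.cl (op.map f) := rfl
/-- `RtOp.map` on `had`. [folklore] -/
@[simp] theorem RtOp.map_had' {α β : Type} (f : α → β) (a : α) : (RtOp.had a).map f = RtOp.had (f a) := rfl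
/-- `RtOp.map` on `chad`. [folklore] -/
@[simp] theorem RtOp.map_chad' {α β : Type} (f : α → β) (c a : α) : (RtOp.chad c a).map f = RtOp.chad (f c) (f a) := rfl
/-- `RtOp.map` on `oracle`. [folklore] -/
@[simp] theorem RtOp.map_oracle' {α β : Type} (f : α → β) (qs : List α) (t : α) :
    (RtOp.oracle qs t).map f = RtOp.oracle (qs.map f) (f t) := rfl

/-- The carry chain as a loop. [folklore] -/
theorem clChain_eq_map (n L r L' : ℕ) : ∀ (l₀ : ℕ),
    clChain (kW n L r l₀) ((List.range' l₀ L').map (bW n)) ((List.range' l₀ L').map fun l => kW n L r (l + 1)) =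
      (List.range' l₀ L').map fun l => ClOp.toffoli (kW n L r l) (bW n l) (kW n L r (l + 1)) := by
  induction L' with
  | zero => intro l₀; simp
  | succ L' ih => intro l₀; rw [List.range'_succ]; simp [ih (l₀ + 1)]

/-- `incrOps` as loops. [folklore] -/
theorem incrOps_eq (n L r : ℕ) : incrOps n L r = ClOp.cnot (oW n) (kW n L r 0) ::
    ((List.range L).map (fun l => ClOp.toffoli (kW n L r l) (bW n l) (kW n L r (l + 1))) ++
      (List.range L).map fun l => ClOp.cnot (kW n L r l) (bW n l)) := by
  rw [incrOps, List.range_eq_range', clChain_eq_map]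

variable {env}

/-- **The increment generator prints the shifted increment.** [folklore] -/
theorem out_incrG (hL : env .xL = rtL (env .xn)) :
    incrG.out env = (incrOps (env .xn) (env .xL) (env .rr)).flatMap
      fun op => (RtOp.cl (op.map (· + blkBase (env .xn) (env .bi)))).toks := by
  have hxl : ∀ j, Function.update env RV.ll j RV.xn = env .xn := fun j => by simp
  have hLl : ∀ j, Function.update env RV.ll j RV.xL = env .xL := fun j => by simp
  have hblk : ∀ j, (blkE (.var .bi)).eval (Function.update env .ll j) = blkBase (env .xn) (env .bi) := fun j => by
    rw [eval_blkE _ _ (by rw [hLl, hxl]; exact hL)]; simp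
  have hblk0 : (blkE (.var .bi)).eval env = blkBase (env .xn) (env .bi) := by rw [eval_blkE _ _ hL]; simp
  rw [incrOps_eq]
  simp [incrG, GStmt.out, sh, LE, hblk, hblk0, List.flatMap_append, List.flatMap_map]

/-- **The oracle generator prints the shifted oracle query.** [folklore] -/
theorem out_oracleG (hL : env .xL = rtL (env .xn)) :
    oracleG.out env = (RtOp.oracle ((queryWires (env .xn) (env .xL)).map (· + blkBase (env .xn) (env .bi)))
      (tW (env .xn) + blkBase (env .xn) (env .bi))).toks := by
  have hxl : ∀ j, Function.update env RV.ll j RV.xn = env .xn := fun j => by simp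
  have hLl : ∀ j, Function.update env RV.ll j RV.xL = env .xL := fun j => by simp
  have hblk : ∀ j, (blkE (.var .bi)).eval (Function.update env .ll j) = blkBase (env .xn) (env .bi) := fun j => by
    rw [eval_blkE _ _ (by rw [hLl, hxl]; exact hL)]; simp
  have hblk0 : (blkE (.var .bi)).eval env = blkBase (env .xn) (env .bi) := by rw [eval_blkE _ _ hL]; simp
  simp only [oracleG, GStmt.out, out_ticksG, out_wireG, GExpr.eval, nE, LE, sh, hxl, Function.update_self, hblk, hblk0,
    eval_bWL, eval_tWL, flatMap_range_const, RtOp.toks, oracleToks, queryWires, List.length_map, List.length_append,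
    List.length_range, List.map_append, List.map_map, List.flatMap_append, List.flatMap_map, List.append_assoc,
    List.flatMap_singleton, List.cons_append]
  simp [litT]

/-- **The block generator prints the shifted block program.** [folklore] -/
theorem out_blockG (hL : env .xL = rtL (env .xn)) :
    blockG.out env = ((blockOps (env .xn) (env .xL) (env .bi)).map (RtOp.map (· + blkBase (env .xn) (env .bi)))).flatMap RtOp.toks := by
  have hxr : ∀ j, Function.update env RV.rr j RV.xn = env .xn := fun j => by simp
  have hLr : ∀ j, Function.update env RV.rr j RV.xL = env .xL := fun j => by simp
  have hbr : ∀ j, Function.update env RV.rr j RV.bi = env .bi := fun j => by simp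
  have hxl : ∀ j, Function.update env RV.ll j RV.xn = env .xn := fun j => by simp
  have hLl : ∀ j, Function.update env RV.ll j RV.xL = env .xL := fun j => by simp
  have hblk : ∀ j, (blkE (.var .bi)).eval (Function.update env .ll j) = blkBase (env .xn) (env .bi) := fun j => by
    rw [eval_blkE _ _ (by rw [hLl, hxl]; exact hL)]; simp
  have hblk0 : (blkE (.var .bi)).eval env = blkBase (env .xn) (env .bi) := by rw [eval_blkE _ _ hL]; simp
  have hinc : ∀ k, incrG.out (Function.update env .rr k) = (incrOps (env .xn) (env .xL) k).flatMap
      fun op => (RtOp.cl (op.map (· + blkBase (env .xn) (env .bi)))).toks := fun k => by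
    rw [out_incrG (by rw [hLr, hxr]; exact hL)]; simp
  simp only [blockG, GStmt.out, out_opG, out_hadG, out_chadG, hinc, out_oracleG hL, GExpr.eval, nE, sh, hxl,
    Function.update_self, hblk, hblk0, eval_tWL, blockOps, prefixOps, quantOps, List.map_append, List.map_cons,
    List.map_map, List.flatMap_append, List.flatMap_cons, List.flatMap_map, List.map_flatMap, List.flatMap_assoc,
    List.append_assoc, List.nil_append, List.cons_append, List.flatMap_nil, List.map_nil]
  simp [hW, hblk0]


/-- **The pre-processing generator prints the pre-processing.** [folklore] -/
theorem out_preG : preG.out env = ((preOps (env .xn)).map RtOp.cl).flatMap RtOp.toks := by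
  simp [preG, preOps, nE]

/-- **The post-processing generator prints the token steps and the read-out.** [folklore] -/
theorem out_postG (hL : env .xL = rtL (env .xn)) : postG.out env = ((postOps (env .xn)).map RtOp.cl).flatMap RtOp.toks := by
  have hxb : ∀ j, Function.update env RV.bi j RV.xn = env .xn := fun j => by simp
  have hxc : ∀ j, Function.update env RV.cc j RV.xn = env .xn := fun j => by simp
  have hxbc : ∀ j k, Function.update (Function.update env RV.bi j) RV.cc k RV.xn = env .xn := fun j k => by simp
  have hbbc : ∀ j k, Function.update (Function.update env RV.bi j) RV.cc k RV.bi = j := fun j k => by simp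
  have hh : ∀ j k, (hGE (.var .bi)).eval (Function.update (Function.update env RV.bi j) RV.cc k) = hGlob (env .xn) j := by
    intro j k
    rw [hGE, GExpr.eval, eval_blkE _ _ (by simp [hL])]
    simp [hGlob, hW, nE]
  simp only [postG, GStmt.out, out_seqs, out_opG, List.map_cons, List.map_nil, List.flatMap_cons, List.flatMap_nil,
    List.append_nil, ClOp.map_toffoli', ClOp.map_not', ClOp.map_cnot', eval_uWE, GExpr.eval, hxb, hxc, hxbc, hbbc, hh,
    Function.update_self, eval_mE, eval_thrE, postOps, tokOps, tokGroup, List.map_append, List.map_flatMap,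
    List.flatMap_append, List.flatMap_map]
  rw [List.flatMap_assoc]
  simp only [List.flatMap_assoc, List.flatMap_cons, List.flatMap_nil, List.append_nil]

/-- **The header generator prints the header tokens** (`headerToks` of `RevTableauUniform`). [folklore] -/
theorem out_headerG (hL : env .xL = rtL (env .xn)) : headerG.out env = headerToks (env .xn) (rtAnc (env .xn)) := by
  simp [headerG, GStmt.out, headerToks, flatMap_range_const, eval_ancE _ hL, litT]

/-- **The generator prints the header followed by the tokens of the whole program.** [folklore] -/
theorem out_descG (n : ℕ) :
    descG.out (GenProg.initEnv₂ .xn .xL n (rtL n)) = headerToks n (rtAnc n) ++ (allOps n).flatMap RtOp.toks := by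
  set env₀ := GenProg.initEnv₂ RV.xn RV.xL n (rtL n) with henv
  have hn : env₀ .xn = n := by simp [henv, GenProg.initEnv₂]
  have hLv : env₀ .xL = rtL n := by simp [henv, GenProg.initEnv₂]
  have hL : env₀ .xL = rtL (env₀ .xn) := by rw [hn, hLv]
  have hxb : ∀ j, Function.update env₀ RV.bi j RV.xn = n := fun j => by simp [hn]
  have hLb : ∀ j, Function.update env₀ RV.bi j RV.xL = rtL n := fun j => by simp [hLv]
  have hblk : ∀ j, blockG.out (Function.update env₀ .bi j) =
      ((blockOps n (rtL n) j).map (RtOp.map (· + blkBase n j))).flatMap RtOp.toks := fun j => by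
    rw [out_blockG (by rw [hLb, hxb])]; simp [hn, hLv]
  simp only [descG, GStmt.out, out_headerG hL, out_preG, out_postG hL, hn, eval_mE, hblk, allOps, blocksOps,
    List.flatMap_append]
  rw [List.flatMap_assoc]

/-- **The generator renders the description of the big circuit**:
`render 0 (out descG (n, L)) = sigmaEncode ⟨n, rtAnc n, bigCirc n⟩`. [Arora–Barak 2009, §6.2 and proof of Thm. 6.15] [folklore] -/
theorem render_out_descG (n : ℕ) :
    Tok.render 0 (descG.out (GenProg.initEnv₂ .xn .xL n (rtL n))) = QCircuit.sigmaEncode ⟨n, rtAnc n, bigCirc n⟩ := by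
  rw [out_descG, render_headerToks, ← List.append_nil ((allOps n).flatMap RtOp.toks), render_flatMap_rtoks, Tok.render_nil,
    List.append_nil, ← encode_bigCirc]
  change _ = boolPair (encodeNat n) (boolPair (unaryEncodeNat (rtAnc n)) (QCircuit.encode (bigCirc n)))
  rw [boolPair_eq, boolPair_eq, RevDesc.unaryEncodeNat_eq_replicate, dbl_replicate]
  simp

/-! ### Loop-variable hygiene of the generator -/

/-- The input variable `xn` is not a loop variable of the (closed) generator. [folklore] -/
theorem xn_not_mem_loopVars_descG : RV.xn ∉ descG.loopVars := by decide

/-- The input variable `xL` is not a loop variable of the generator. [folklore] -/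
theorem xL_not_mem_loopVars_descG : RV.xL ∉ descG.loopVars := by decide

/-- The generator does not reuse loop variables. [folklore] -/
theorem noReuse_descG : descG.noReuse = true := by decide

/-! ### The preprocessor `1ⁿ ↦ 1ⁿ 0 bin(m(n))` -/

/-- **The one-counter preprocessor**: `n` literal `1`s, a `0`, then the binary numeral of
`m(n) = rtBlocks n` (so that the two-counter parser reads `n` and `|bin m(n)| = size m(n)`). [folklore] -/
def pre1G : GS :=
  .seq (.loop .uu (.var .xn) (.emit [Tok.lit true])) (.seq (.emit [Tok.lit false]) (.seq (ticksG mE) (.emit [Tok.dump false false])))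

/-- The stream of the preprocessor. [folklore] -/
theorem out_pre1G (n : ℕ) : pre1G.out (GenProg.initEnv .xn n) =
    List.replicate n (Tok.lit true) ++ Tok.lit false :: (List.replicate (rtBlocks n) Tok.tick ++ [Tok.dump false false]) := by
  simp [pre1G, GStmt.out, flatMap_range_const, GenProg.initEnv]

/-- A numeral with bit multiplicity `1` is the binary numeral. [folklore] -/
theorem numeral_one (c : ℕ) : Tok.numeral 1 c = encodeNat c := by
  unfold Tok.numeral
  induction encodeNat c with
  | nil => rfl
  | cons b l ih => rw [List.flatMap_cons, ih]; rfl

/-- **The rendered stream of the preprocessor**: `1ⁿ 0 bin(m(n))`. [folklore] -/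
theorem render_out_pre1G (n : ℕ) :
    Tok.render 0 (pre1G.out (GenProg.initEnv .xn n)) = List.replicate n true ++ false :: encodeNat (rtBlocks n) := by
  rw [out_pre1G, show List.replicate n (Tok.lit true) = litT (List.replicate n true) by simp [litT], render_litT, Tok.render_lit,
    Tok.render_numeral, Tok.render_nil, List.append_nil, Tok.mult_ff, numeral_one]

/-- The preprocessor's loop variables avoid the input variable and are not reused. [folklore] -/
theorem pre1G_hygiene : RV.xn ∉ pre1G.loopVars ∧ pre1G.noReuse = true := by
  constructor
  · simp [pre1G, GStmt.loopVars, ticksG]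
  · rfl

/-! ### Uniformity -/

/-- **The description of the big circuits is in `FP`**: `z ↦ sigmaEncode ⟨|z|, rtAnc |z|, bigCirc |z|⟩`
(preprocessor, two-counter generator, rendering; `PolyTimeComputable.comp_holds`).
[Arora–Barak 2009, §6.2 and proof of Thm. 6.15] [folklore] -/
theorem descBig_mem_FP :
    (fun z : List Bool => QCircuit.sigmaEncode (G := cliffordT) ⟨z.length, rtAnc z.length, bigCirc z.length⟩) ∈ FP := by
  have hpre := GStmt.render_out_mem_FP pre1G .xn pre1G_hygiene.1 pre1G_hygiene.2
  have hgen := GStmt.render_out₂_mem_FP descG .xn .xL xn_not_mem_loopVars_descG xL_not_mem_loopVars_descG noReuse_descG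
  have h := comp_mem_FP hgen hpre
  have e : ((fun w => Tok.render 0 (descG.out (GenProg.parseEnv RV.xn RV.xL (fun _ => 0) w))) ∘ fun z : List Bool =>
      Tok.render 0 (pre1G.out (GenProg.initEnv RV.xn z.length))) =
      fun z : List Bool => QCircuit.sigmaEncode (G := cliffordT) ⟨z.length, rtAnc z.length, bigCirc z.length⟩ := by
    funext z
    simp only [Function.comp_apply]
    rw [render_out_pre1G, GenProg.parseEnv_replicate (by decide), TM2Pass.length_encodeNat_eq_size]
    exact render_out_descG z.length
  rwa [e] at h

end RtGen

open RtGen in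
/-- **The Raz–Tal family is polynomial-time uniform**: its description function is the finite patch
(`mem_FP_of_eqOn_le`) below `n₀` of the description of the big circuits (`descBig_mem_FP`).
[cite: RazTalJACM2022, App. A ("this is a BQP machine since Q₁ runs in poly(n) time … we may hardwire … n < n₀")] -/
theorem rtFamily_isUniform (n₀ : ℕ) (tbl : ℕ → Bool) : (rtFamily n₀ tbl).IsUniform := by
  refine QCircuitFamily.isUniform_of_mem_FP _ (mem_FP_of_eqOn_le descBig_mem_FP n₀ fun z hz => ?_)
  simp [rtFamily, not_lt.2 hz]

end RazTalMachine

open RazTalMachine in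
/-- **Discharge of `RazTal2022_bqpMachine`** (Raz–Tal, J. ACM 69 (2022), App. A with Claim 8.1 and
§6: the uniform `BQP^O` machine running `Q₁` on the level-`n` window, in H21's `BQPRel` model —
`m(n)` exact Clifford+T copies of the one-query Forrelation circuit on disjoint blocks, one oracle
gate each on the `ℓ(n)` address wires, controlled-Hadamard mixing, reversible threshold count;
polynomial-time uniform by a generator program). [cite: RazTalJACM2022, App. A] -/
theorem razTal2022_bqpMachine_holds : RazTal2022_bqpMachine :=
  razTal2022_bqpMachine_of_isUniform rtFamily_isUniform

end Literature.Computability.QuantumComplexity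

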